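import Summits.AtomisticToContinuum.Crystallization.Theorems.ShellTrichotomy.Negative.WithoutHardCore

/-!
# `ShellTrichotomy` (stmt-AtomisticToContinuum-18070), negative side IV: the gap pins `η` from below

* `not_shellCloseTo_of_gapPair` — if the pattern's pair distances avoid `(1, √2)` (true for fcc and hcp:
  `fcc_dist_dichotomy`, `hcp_dist_dichotomy`, integer models) and the shell has a pair at distance `d`
  with `1 + 2η < d` and `d + 2η < √2`, then the shell is not `η`-close to the pattern (an `η`-matching is a
  map distorting distances by `≤ 2η`).
* `Wg` — a feasible all-degree-4 gapped twelve-shell on the anticuboctahedron graph with a quad diagonal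
  AT the gap (`1.26062`; integer model `WgInt` in units of `10⁻⁶`, every hypothesis of the crux certified by
  `decide`): the butterfly twist of the hcp pattern (`ψ = 0.17`) projected onto the feasible set
  (seat script `compute/gapwitness.py`).
* `not_trichotomyAt_eta_0075` — hence, with every other constant as in the crux, the closeness constant
  cannot be lowered to `3/40`: RIGOROUS (if weak) tightness, `η ≥ (√2 − 63/50)/2 ≈ 0.0771` being forced
  by the distance relaxation alone because the gap value is attained on the feasible set.  The numerical
  bottleneck optimum over the hcp-graph family is `0.1833` (kit j021991; near-miss in the crux workfile
  `Cruxes/ShellTrichotomy/Disproof.lean`), versus the crux's `1/5`.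

Negative-side support (no route item is concluded positively).  Disprover seat
refuter-cdisprove-stmt-AtomisticToContinuum-18070-0, 2026-08-17.
-/

noncomputable section

namespace Summit.AtomisticToContinuum.Crystallization.Theorems.ShellTrichotomyNegative

open Literature.Geometry.DiscreteGeometry
open Summit.AtomisticToContinuum.Crystallization.Theorems.ShellCensusNegative

/-! ### The gap pins `η` from below: a shell with a pair AT the gap is `(√2 − 63/50)/2`-far

If some non-bonded pair of an all-degree-4 gapped shell sits at distance `d ∈ [63/50, 1.2642)`, no
`η`-matching with `2η < min (d − 1, √2 − d)` exists: the matching is injective and distorts distances by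
`≤ 2η`, but the patterns have NO pair distance strictly between `1` and `√2`.  Such shells exist (the
soft-mode flexes of either pattern slide the quad diagonals from `√2` down to the gap; witness `Wg` below,
the rounded bottleneck maximiser of kit j021991), so the crux's closeness constant can never be taken
below `(√2 − 63/50)/2 ≈ 0.0771` — a rigorous (if weak) companion of the numerical tightness `0.1833`. -/

/-- distance-gap obstruction: a shell pair at distance `d` with `1 + 2η < d` and `d + 2η < √2` forbids an
`η`-matching with any isometric copy of a pattern whose pair distances avoid `(1, √2)`. [folklore] -/
theorem not_shellCloseTo_of_gapPair {η : ℝ} {T P : Finset (EuclideanSpace ℝ (Fin 3))}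
    (hP : ∀ p ∈ P, ∀ q ∈ P, dist p q ≤ 1 ∨ Real.sqrt 2 ≤ dist p q)
    {a b : EuclideanSpace ℝ (Fin 3)} (ha : a ∈ T) (hb : b ∈ T)
    (h1 : 1 + 2 * η < dist a b) (h2 : dist a b + 2 * η < Real.sqrt 2) : ¬ ShellCloseTo η T P := by
  classical
  rintro ⟨A, hA⟩
  obtain ⟨f, hfQ, hfinj, hfd⟩ := exists_map_of_etaMatched hA
  obtain ⟨p, hp, hpa⟩ := Finset.mem_image.1 (hfQ a ha)
  obtain ⟨q, hq, hqb⟩ := Finset.mem_image.1 (hfQ b hb)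
  have hdist : dist (f a) (f b) = dist p q := by rw [← hpa, ← hqb, LinearIsometry.dist_map]
  have hlo : dist a b ≤ dist a (f a) + dist (f a) (f b) + dist (f b) b := dist_triangle4 _ _ _ _
  have hhi : dist (f a) (f b) ≤ dist (f a) a + dist a b + dist b (f b) := dist_triangle4 _ _ _ _
  have h3 := hfd a ha
  have h4 := hfd b hb
  rw [dist_comm] at h3
  have h4' : dist (f b) b ≤ η := by rw [dist_comm]; exact hfd b hb
  rcases hP p hp q hq with hle | hge
  · rw [← hdist] at hle; linarith [hfd a ha]
  · rw [← hdist] at hge; linarith [hfd a ha]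

/-- a `√N`-scaled integer pattern whose squared integer distances are `≤ N` or `≥ 2N` has real pair
distances `≤ 1` or `≥ √2`. [folklore] -/
theorem dist_dichotomy_scaledPattern {S : Finset (Fin 3 → ℤ)} {N : ℕ} (hN : N ≠ 0)
    (hS : ∀ v ∈ S, ∀ w ∈ S, sqNormInt (v - w) ≤ N ∨ (2 * N : ℤ) ≤ sqNormInt (v - w)) :
    ∀ p ∈ scaledPattern S N, ∀ q ∈ scaledPattern S N, dist p q ≤ 1 ∨ Real.sqrt 2 ≤ dist p q := by
  intro p hp q hq
  obtain ⟨v, hv, rfl⟩ := Finset.mem_image.1 hp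
  obtain ⟨w, hw, rfl⟩ := Finset.mem_image.1 hq
  have hNpos : (0 : ℝ) < N := by exact_mod_cast Nat.pos_of_ne_zero hN
  have hc : (0 : ℝ) ≤ (Real.sqrt N)⁻¹ := by positivity
  have hsN : 0 < Real.sqrt N := Real.sqrt_pos.2 hNpos
  rw [dist_scaled_intVec _ hc]
  rcases hS v hv w hw with h | h
  · left
    have h' : (sqNormInt (v - w) : ℝ) ≤ (N : ℝ) := by exact_mod_cast h
    rw [inv_mul_le_iff₀ hsN, mul_one]
    calc Real.sqrt (sqNormInt (v - w) : ℝ) ≤ Real.sqrt N := Real.sqrt_le_sqrt h'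
      _ = Real.sqrt N := rfl
  · right
    have h' : ((2 * N : ℤ) : ℝ) ≤ (sqNormInt (v - w) : ℝ) := by exact_mod_cast h
    rw [le_inv_mul_iff₀ hsN, ← Real.sqrt_mul hNpos.le]
    exact Real.sqrt_le_sqrt (by push_cast at h' ⊢; linarith)

/-- fcc: pair distances are `≤ 1` or `≥ √2`. [cite: ConwaySloane1999, Ch. 4 §6.3] -/
theorem fcc_dist_dichotomy : ∀ p ∈ fccKissingPattern, ∀ q ∈ fccKissingPattern, dist p q ≤ 1 ∨ Real.sqrt 2 ≤ dist p q :=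
  dist_dichotomy_scaledPattern two_ne_zero (by decide)

/-- hcp: pair distances are `≤ 1` or `≥ √2`. [cite: HalesDSP2012, §1.3] -/
theorem hcp_dist_dichotomy : ∀ p ∈ hcpKissingPattern, ∀ q ∈ hcpKissingPattern, dist p q ≤ 1 ∨ Real.sqrt 2 ≤ dist p q :=
  dist_dichotomy_scaledPattern (by norm_num) (by decide)

/-- integer model (units of `10⁻⁶`) of the gap-pair witness: a feasible all-degree-4 gapped shell on the
anticuboctahedron graph with a quad diagonal at the gap (rounded bottleneck maximiser of kit j021991). [folklore] -/
def WgInt : Finset (Fin 3 → ℤ) :=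
  {![750773, -657792, 53308],
   ![-755319, 653247, -44218],
   ![653247, -44218, -755319],
   ![-657792, 53308, 750773],
   ![53308, 750773, -657792],
   ![-44218, -755319, 653247],
   ![793863, 600926, -962],
   ![600926, -962, 793863],
   ![-962, 793863, 600926],
   ![-328292, -135355, -930180],
   ![-135355, -930180, -328292],
   ![-930180, -328292, -135355]}

/-- the two ends of the pair at the gap [folklore] -/
def Wga : Fin 3 → ℤ := ![750773, -657792, 53308]
/-- (second end) [folklore] -/
def Wgb : Fin 3 → ℤ := ![793863, 600926, -962]

/-- twelve distinct vectors. [folklore] -/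
theorem WgInt_card : WgInt.card = 12 := by decide

/-- radii in `[49/50, 51/50]` (squared, units `10⁻¹²`). [folklore] -/
theorem WgInt_norm : ∀ v ∈ WgInt, (960400000000 : ℤ) ≤ sqNormInt v ∧ sqNormInt v ≤ 1040400000000 := by decide

/-- pairs: hard core, and bond (`≤ 1.02²`) or far (`≥ 1.26²`). [folklore] -/
theorem WgInt_dist : ∀ v ∈ WgInt, ∀ w ∈ WgInt, v ≠ w →
    (960400000000 : ℤ) ≤ sqNormInt (v - w) ∧ (sqNormInt (v - w) ≤ 1040400000000 ∨ (1587600000000 : ℤ) ≤ sqNormInt (v - w)) := by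
  decide

/-- all bond-degrees are four. [folklore] -/
theorem WgInt_degree : ∀ v ∈ WgInt, (WgInt.filter fun w => w ≠ v ∧ sqNormInt (v - w) ≤ 1040400000000).card = 4 := by
  decide

/-- the pair ends are witness points. [folklore] -/
theorem Wga_mem : Wga ∈ WgInt := by decide
/-- (second end) [folklore] -/
theorem Wgb_mem : Wgb ∈ WgInt := by decide

/-- the pair sits at the gap: squared distance in `[1.26², 1589172984524·10⁻¹²]`. [folklore] -/
theorem Wgab_dist : (1587600000000 : ℤ) ≤ sqNormInt (Wga - Wgb) ∧ sqNormInt (Wga - Wgb) ≤ 1589172984524 := by decide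

/-- the witness map `v ↦ v / 10⁶` [folklore] -/
def mmap (v : Fin 3 → ℤ) : (EuclideanSpace ℝ (Fin 3)) := ((1000000 : ℕ) : ℝ)⁻¹ • intVec v
/-- **the gap-pair witness shell** [folklore] -/
def Wg : Finset (EuclideanSpace ℝ (Fin 3)) := WgInt.image mmap

/-- the witness map is injective. [folklore] -/
theorem mmap_injective : Function.Injective mmap := by
  have hc : ((1000000 : ℕ) : ℝ)⁻¹ ≠ 0 := by positivity
  exact (smul_right_injective (EuclideanSpace ℝ (Fin 3)) hc).comp intVec_injective
/-- norms from the integer model. [folklore] -/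
theorem norm_mmap (v : Fin 3 → ℤ) : ‖mmap v‖ = Real.sqrt (sqNormInt v : ℝ) / (1000000 : ℕ) := norm_div_intVec _ _
/-- distances from the integer model. [folklore] -/
theorem dist_mmap (v w : Fin 3 → ℤ) : dist (mmap v) (mmap w) = Real.sqrt (sqNormInt (v - w) : ℝ) / (1000000 : ℕ) :=
  dist_div_intVec _ _ _

/-- bond test in integers at scale `10⁶`. [folklore] -/
theorem dist_mmap_le_iff (v w : Fin 3 → ℤ) : dist (mmap v) (mmap w) ≤ 1 + 1 / 50 ↔ sqNormInt (v - w) ≤ 1040400000000 := by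
  rw [dist_mmap, sqrt_div_le_iff (by norm_num) (Literature.Barriers.AtomisticToContinuum.sqNormInt_nonneg _) (by norm_num)]
  constructor
  · intro h
    have h' : (sqNormInt (v - w) : ℝ) ≤ ((1040400000000 : ℤ) : ℝ) := by push_cast at h ⊢; nlinarith [h]
    exact_mod_cast h'
  · intro h
    have h' : (sqNormInt (v - w) : ℝ) ≤ ((1040400000000 : ℤ) : ℝ) := by exact_mod_cast h
    push_cast at h' ⊢; nlinarith [h']

/-- twelve points. [folklore] -/
theorem Wg_card : Wg.card = 12 := by
  rw [Wg, Finset.card_image_of_injective _ mmap_injective, WgInt_card]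

/-- radii hypothesis. [folklore] -/
theorem Wg_norm : ∀ x ∈ Wg, 1 - 1 / 50 ≤ ‖x‖ ∧ ‖x‖ ≤ 1 + 1 / 50 := by
  intro x hx
  obtain ⟨v, hv, rfl⟩ := Finset.mem_image.1 hx
  obtain ⟨h1, h2⟩ := WgInt_norm v hv
  have h1' : ((960400000000 : ℤ) : ℝ) ≤ (sqNormInt v : ℝ) := by exact_mod_cast h1
  have h2' : (sqNormInt v : ℝ) ≤ ((1040400000000 : ℤ) : ℝ) := by exact_mod_cast h2
  rw [norm_mmap]
  constructor
  · apply le_sqrt_div (by norm_num) (by norm_num); push_cast at h1' ⊢; nlinarith [h1']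
  · apply sqrt_div_le (by norm_num) (by norm_num); push_cast at h2' ⊢; nlinarith [h2']

/-- pair hypotheses (hard core; bond or far). [folklore] -/
theorem Wg_dist : ∀ x ∈ Wg, ∀ y ∈ Wg, x ≠ y → 1 - 1 / 50 ≤ dist x y ∧ (dist x y ≤ 1 + 1 / 50 ∨ 63 / 50 ≤ dist x y) := by
  intro x hx y hy hxy
  obtain ⟨v, hv, rfl⟩ := Finset.mem_image.1 hx
  obtain ⟨w, hw, rfl⟩ := Finset.mem_image.1 hy
  have hvw : v ≠ w := by rintro rfl; exact hxy rfl
  obtain ⟨h1, h2⟩ := WgInt_dist v hv w hw hvw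
  have h1' : ((960400000000 : ℤ) : ℝ) ≤ (sqNormInt (v - w) : ℝ) := by exact_mod_cast h1
  refine ⟨?_, ?_⟩
  · rw [dist_mmap]; apply le_sqrt_div (by norm_num) (by norm_num); push_cast at h1' ⊢; nlinarith [h1']
  · rcases h2 with h2 | h2
    · exact Or.inl ((dist_mmap_le_iff v w).2 h2)
    · right
      have h2' : ((1587600000000 : ℤ) : ℝ) ≤ (sqNormInt (v - w) : ℝ) := by exact_mod_cast h2
      rw [dist_mmap]; apply le_sqrt_div (by norm_num) (by norm_num); push_cast at h2' ⊢; nlinarith [h2']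

/-- all bond-degrees of the witness are four. [folklore] -/
theorem Wg_degree : ∀ x ∈ Wg, (Wg.filter fun w => w ≠ x ∧ dist x w ≤ 1 + 1 / 50).card = 4 := by
  classical
  intro x hx
  obtain ⟨v, hv, rfl⟩ := Finset.mem_image.1 hx
  rw [← WgInt_degree v hv, Wg, Finset.filter_image, Finset.card_image_of_injective _ mmap_injective]
  congr 1
  apply Finset.filter_congr
  intro w _
  simp only [mmap_injective.ne_iff, dist_mmap_le_iff]

/-- `√2 > 1.4142`. [folklore] -/
theorem sqrt_two_gt : (1.4142 : ℝ) < Real.sqrt 2 := by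
  rw [show (1.4142 : ℝ) = Real.sqrt (1.4142 ^ 2) by rw [Real.sqrt_sq (by norm_num)]]
  exact Real.sqrt_lt_sqrt (by norm_num) (by norm_num)

/-- **`η`-tightness, rigorous part**: with every other constant as in the crux, the closeness constant
cannot be lowered to `3/40 = 0.075` — the witness `Wg` is a feasible all-degree-4 gapped shell with a
(non-bonded) pair at distance `∈ [63/50, 1.2642)`, hence more than `0.15/2`-far in the distance sense
from both patterns (their pair distances avoid `(1, √2)`); the degree escapes fail since all degrees are
four.  Mechanism: the gap `63/50` is attained on the feasible set (soft modes slide quad diagonals from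
`√2` to the gap), so `η ≥ (√2 − 63/50)/2 ≈ 0.0771` is forced by the distance relaxation alone; the
numerical bottleneck optimum is `0.1833` (NEAR-MISS `not_trichotomyAt_eta_018` in the workfile). [folklore] -/
theorem not_trichotomyAt_eta_0075 :
    ¬ TrichotomyAt (1 - 1 / 50) (1 + 1 / 50) (1 - 1 / 50) (1 + 1 / 50) (63 / 50) (3 / 40) := by
  intro h
  have ha : mmap Wga ∈ Wg := Finset.mem_image_of_mem _ Wga_mem
  have hb : mmap Wgb ∈ Wg := Finset.mem_image_of_mem _ Wgb_mem
  obtain ⟨hq1, hq2⟩ := Wgab_dist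
  have hq1' : ((1587600000000 : ℤ) : ℝ) ≤ (sqNormInt (Wga - Wgb) : ℝ) := by exact_mod_cast hq1
  have hq2' : (sqNormInt (Wga - Wgb) : ℝ) ≤ ((1589172984524 : ℤ) : ℝ) := by exact_mod_cast hq2
  have hd1 : 63 / 50 ≤ dist (mmap Wga) (mmap Wgb) := by
    rw [dist_mmap]; apply le_sqrt_div (by norm_num) (by norm_num); push_cast at hq1' ⊢; nlinarith [hq1']
  have hd2 : dist (mmap Wga) (mmap Wgb) ≤ 1.2642 := by
    rw [dist_mmap]; apply sqrt_div_le (by norm_num) (by norm_num); push_cast at hq2' ⊢; nlinarith [hq2']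
  have h1 : 1 + 2 * (3 / 40 : ℝ) < dist (mmap Wga) (mmap Wgb) := by linarith
  have h2 : dist (mmap Wga) (mmap Wgb) + 2 * (3 / 40 : ℝ) < Real.sqrt 2 := by linarith [sqrt_two_gt]
  rcases h Wg Wg_card Wg_norm Wg_dist with hA | hA | ⟨v, hv, h5⟩ | ⟨v, hv, h3⟩
  · exact not_shellCloseTo_of_gapPair fcc_dist_dichotomy ha hb h1 h2 hA
  · exact not_shellCloseTo_of_gapPair hcp_dist_dichotomy ha hb h1 h2 hA
  · rw [Wg_degree v hv] at h5; omega
  · rw [Wg_degree v hv] at h3; omega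


end Summit.AtomisticToContinuum.Crystallization.Theorems.ShellTrichotomyNegative

end
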